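import Summits.CriticalPhenomena.PercolationContinuityZ3.Theorems.PercNearOneGluingNoHeavyLowerTailGZGladkovWCert

/-!
# GERM-E on the Wheatstone skeleton, bridge slot (cell level): Gladkov's margin under bridge substitution

Hub-free bond percolation on the Wheatstone skeleton `a–u (a₁), a–v (a₂), u–b (b₁), v–b (b₂)` whose bridge
slot `u–v` carries an ARBITRARY finite two-terminal graph `B ∋ x` attached at `u, v` only; `B` enters through
the partition law of `{u,v,x}` in `B`: `τ = P(uvx)`, `α = P(ux|v)`, `β = P(vx|u)`, `γ = P(uv|x)`
(`θ_B = τ+γ`, `π_u = τ+α`, `π_v = τ+β`, Gladkov margin `M_B = π_uπ_v − τ²/(2θ_B)`).  With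
`S = a₁b₁ + a₂b₂ − a₁a₂b₁b₂` (a~b through the fans), `C = a₁b₂(1−b₁)(1−a₂) + a₂b₁(1−a₁)(1−b₂)` (the slot is
pivotal), `A = a₁+a₂−a₁a₂`, `B' = b₁+b₂−b₁b₂`, `U_a = a₁+(1−a₁)a₂b₂b₁`, `U_b = b₁+(1−b₁)b₂a₂a₁`,
`V_a = a₂+(1−a₂)a₁b₁b₂`, `V_b = b₂+(1−b₂)b₁a₁a₂`, `S_u = S − a₂b₂(1−a₁)(1−b₁)`, `S_v = S − a₁b₁(1−a₂)(1−b₂)`,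
the composite `H = W[B]` has `P(a~x) = τA+αU_a+βV_a`, `P(b~x) = τB'+αU_b+βV_b`, `P(a~b) = S + C(τ+γ)`,
`P(a~b~x) = τS+αS_u+βS_v+Cτ` (exact enumeration, prim-ineq-prove-2 MEMO-24 §6).
**`bridge_slot_margin`: `C·M_B ≤ M_H`.**  Hence Gladkov's `P(abx)² ≤ 2P(ab)P(ax)P(bx)` propagates through
bridge substitution; for `x` inside the bridge piece `a, b, x` lie on no common face of the (planar) composite,
so this case is not covered by arXiv:2408.08457 Thm 6.1 (print: constant 8, Thm 1.1).
Proof: two-class convexity of `u²/v` (`GZGladkovSP.sq_add_div_le`), cancellation of the piece's `τ²/θ_B`,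
and nonnegativity of the quadratic form `2S·(P(a~x)P(b~x) − T²/(2S) − Cπ_uπ_v)` in `(τ,α,β)` whose
coefficients are: `S²` (identity `A·B' = S + C`), `2S·q_τα`, `2S·q_τβ` (three-term identities),
`2S·q_αα = 2S·M_{C₄}(a,b;u)` (parallel step of `GZGladkovSP`), and `k_αβ + k_αα ≥ 0`, `k_αβ + k_ββ ≥ 0`
(exact tensor-Bernstein certificate of multidegree (3,3,3,3), written as a two-level Bernstein expansion so
that every `ring` step is small), combined by diagonal dominance of the `(α,β)` block.
-/

namespace Summit.CriticalPhenomena.PercolationContinuityZ3.Theorems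

namespace GZGladkovW

/-- A binary quadratic form `p α² + m αβ + q β²` with `p, q ≥ 0`, `m + p ≥ 0`, `m + q ≥ 0` is nonnegative on
the nonnegative quadrant. -/
theorem quad_form_nonneg_of_diag_dominance {p m q α β : ℝ} (hp : 0 ≤ p) (hq : 0 ≤ q)
    (hmp : 0 ≤ m + p) (hmq : 0 ≤ m + q) (hα : 0 ≤ α) (hβ : 0 ≤ β) :
    0 ≤ p * α ^ 2 + m * (α * β) + q * β ^ 2 := by
  rcases le_total 0 m with hm | hm
  · positivity
  rcases le_total α β with h | h
  · have h1 : m * β ^ 2 ≤ m * (α * β) := by nlinarith [mul_le_mul_of_nonneg_right h hβ]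
    nlinarith [mul_nonneg hmq (sq_nonneg β), mul_nonneg hp (sq_nonneg α)]
  · have h1 : m * α ^ 2 ≤ m * (α * β) := by nlinarith [mul_le_mul_of_nonneg_left h hα]
    nlinarith [mul_nonneg hmp (sq_nonneg α), mul_nonneg hq (sq_nonneg β)]

/-- `q_τα = A·U_b + B'·U_a − C − S_u` is a sum of three nonnegative products. -/
theorem q_ta_nonneg {a₁ a₂ b₁ b₂ : ℝ} (ha₁ : 0 ≤ a₁) (ha₁' : a₁ ≤ 1) (ha₂ : 0 ≤ a₂) (ha₂' : a₂ ≤ 1)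
    (hb₁ : 0 ≤ b₁) (hb₁' : b₁ ≤ 1) (hb₂ : 0 ≤ b₂) (hb₂' : b₂ ≤ 1) :
    0 ≤ (a₁ + a₂ - a₁ * a₂) * (b₁ + (1 - b₁) * b₂ * a₂ * a₁) + (b₁ + b₂ - b₁ * b₂) * (a₁ + (1 - a₁) * a₂ * b₂ * b₁)
      - (a₁ * b₂ * (1 - b₁) * (1 - a₂) + a₂ * b₁ * (1 - a₁) * (1 - b₂))
      - ((a₁ * b₁ + a₂ * b₂ - a₁ * a₂ * b₁ * b₂) - a₂ * b₂ * (1 - a₁) * (1 - b₁)) := by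
  have key : (a₁ + a₂ - a₁ * a₂) * (b₁ + (1 - b₁) * b₂ * a₂ * a₁) + (b₁ + b₂ - b₁ * b₂) * (a₁ + (1 - a₁) * a₂ * b₂ * b₁)
      - (a₁ * b₂ * (1 - b₁) * (1 - a₂) + a₂ * b₁ * (1 - a₁) * (1 - b₂))
      - ((a₁ * b₁ + a₂ * b₂ - a₁ * a₂ * b₁ * b₂) - a₂ * b₂ * (1 - a₁) * (1 - b₁))
      = a₁ * b₁ + (1 - a₁) * a₂ * b₁ * b₂ * (b₁ + b₂ - b₁ * b₂) + a₁ * a₂ * b₂ * (1 - b₁) * (a₁ + a₂ - a₁ * a₂) := by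
    ring
  rw [key]
  have h1 : 0 ≤ 1 - a₁ := by linarith
  have h2 : 0 ≤ 1 - b₁ := by linarith
  have h3 : 0 ≤ b₁ + b₂ - b₁ * b₂ := by nlinarith
  have h4 : 0 ≤ a₁ + a₂ - a₁ * a₂ := by nlinarith
  positivity

/-- `k_αα = 2S·U_aU_b − S_u² ≥ 0`: this is `2θ·M` for the 4-cycle `C₄ = (a–u–b) ∥ (a–v–b)` at `x = u`, which follows
from the parallel step `GZGladkovSP.margin_parallel_nonneg` applied to the path `a–u–b` (margin `a₁b₁/2`)
and the parallel piece `a–v–b` (connection probability `a₂b₂`). -/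
theorem k_aa_nonneg {a₁ a₂ b₁ b₂ : ℝ} (ha₁ : 0 < a₁) (ha₁' : a₁ ≤ 1) (ha₂ : 0 ≤ a₂) (ha₂' : a₂ ≤ 1)
    (hb₁ : 0 < b₁) (hb₁' : b₁ ≤ 1) (hb₂ : 0 ≤ b₂) (hb₂' : b₂ ≤ 1) :
    0 ≤ 2 * (a₁ * b₁ + a₂ * b₂ - a₁ * a₂ * b₁ * b₂) * ((a₁ + (1 - a₁) * a₂ * b₂ * b₁) * (b₁ + (1 - b₁) * b₂ * a₂ * a₁))
      - ((a₁ * b₁ + a₂ * b₂ - a₁ * a₂ * b₁ * b₂) - a₂ * b₂ * (1 - a₁) * (1 - b₁)) ^ 2 := by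
  -- path a–u–b with x = u: τ = a₁b₁, α = a₁(1−b₁), β = (1−a₁)b₁, γ = 0; parallel piece s = a₂b₂
  have hs0 : 0 ≤ a₂ * b₂ := by positivity
  have hs1 : a₂ * b₂ ≤ 1 := by nlinarith
  have hθ : 0 < a₁ * b₁ + 0 := by nlinarith [mul_pos ha₁ hb₁]
  have hM : 0 ≤ (a₁ * b₁ + a₁ * (1 - b₁)) * (a₁ * b₁ + (1 - a₁) * b₁) - (a₁ * b₁) ^ 2 / (2 * (a₁ * b₁ + 0)) := by
    have e1 : (a₁ * b₁ + a₁ * (1 - b₁)) * (a₁ * b₁ + (1 - a₁) * b₁) - (a₁ * b₁) ^ 2 / (2 * (a₁ * b₁ + 0))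
        = a₁ * b₁ / 2 := by
      field_simp
      ring
    rw [e1]; positivity
  have h := GZGladkovSP.margin_parallel_nonneg (τ := a₁ * b₁) (α := a₁ * (1 - b₁)) (β := (1 - a₁) * b₁)
    (γ := 0) (s := a₂ * b₂) (by positivity) (by nlinarith) (by nlinarith) le_rfl (by nlinarith) hs0 hs1 hθ hM
  -- h : 0 ≤ U_a U_b − S_u²/(2S) in path/parallel coordinates; clear the denominator 2S > 0
  have hS : 0 < a₁ * b₁ + a₂ * b₂ - a₁ * a₂ * b₁ * b₂ := by nlinarith [mul_pos ha₁ hb₁, mul_nonneg hs0 (sub_nonneg.2 (show a₁ * b₁ ≤ 1 by nlinarith))]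
  have e2 : a₁ * b₁ + 0 + a₂ * b₂ * (1 - (a₁ * b₁ + 0)) = a₁ * b₁ + a₂ * b₂ - a₁ * a₂ * b₁ * b₂ := by ring
  rw [e2] at h
  have e3 : (a₁ * b₁ + a₁ * (1 - b₁) + a₂ * b₂ * ((1 - a₁) * b₁)) = a₁ + (1 - a₁) * a₂ * b₂ * b₁ := by ring
  have e4 : (a₁ * b₁ + (1 - a₁) * b₁ + a₂ * b₂ * (a₁ * (1 - b₁))) = b₁ + (1 - b₁) * b₂ * a₂ * a₁ := by ring
  have e5 : (a₁ * b₁ + a₂ * b₂ * (a₁ * (1 - b₁) + (1 - a₁) * b₁)) = (a₁ * b₁ + a₂ * b₂ - a₁ * a₂ * b₁ * b₂) - a₂ * b₂ * (1 - a₁) * (1 - b₁) := by ring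
  rw [e3, e4, e5] at h
  have h3 : ((a₁ * b₁ + a₂ * b₂ - a₁ * a₂ * b₁ * b₂) - a₂ * b₂ * (1 - a₁) * (1 - b₁)) ^ 2 /
      (2 * (a₁ * b₁ + a₂ * b₂ - a₁ * a₂ * b₁ * b₂)) ≤ (a₁ + (1 - a₁) * a₂ * b₂ * b₁) * (b₁ + (1 - b₁) * b₂ * a₂ * a₁) := by
    linarith [h]
  rw [div_le_iff₀ (by positivity)] at h3
  nlinarith [h3]

/-- The polynomial identity behind the bridge-slot step, over abstract reals: `2S(π_aπ_b − Cπ_uπ_v) − T²` equals the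
quadratic form in `(τ, α, β)` with the structured coefficients. -/
theorem quad_identity (S C A B Ua Ub Va Vb Su Sv τ α β : ℝ) :
    2 * S * ((τ * A + α * Ua + β * Va) * (τ * B + α * Ub + β * Vb) - C * ((τ + α) * (τ + β)))
        - (τ * S + α * Su + β * Sv) ^ 2 =
      (2 * S * (A * B - C) - S ^ 2) * τ ^ 2 + (2 * S * (A * Ub + B * Ua - C - Su)) * (τ * α)
        + (2 * S * (A * Vb + B * Va - C - Sv)) * (τ * β)
        + ((2 * S * (Ua * Ub) - Su ^ 2) * α ^ 2
            + ((2 * S * (Ua * Vb + Va * Ub - C) - 2 * Su * Sv) + (2 * S * (Ua * Ub) - Su ^ 2)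
                - (2 * S * (Ua * Ub) - Su ^ 2)) * (α * β)
            + (2 * S * (Va * Vb) - Sv ^ 2) * β ^ 2) := by
  ring

/-- **GERM-E on the Wheatstone skeleton, bridge slot** (cell level).  For fan weights in `(0,1)` and bridge-piece partition
masses `τ, α, β, γ ≥ 0` with `θ_B = τ + γ > 0`:  `C·(π_uπ_v − τ²/(2θ_B)) ≤ P(a~x)P(b~x) − P(abx)²/(2P(ab))` for the
composite `W[B]` (cells as in the module docstring), i.e. `C · M_B ≤ M_H`. -/
theorem bridge_slot_margin {a₁ a₂ b₁ b₂ τ α β γ : ℝ} (ha₁ : 0 < a₁) (ha₁' : a₁ < 1) (ha₂ : 0 < a₂) (ha₂' : a₂ < 1)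
    (hb₁ : 0 < b₁) (hb₁' : b₁ < 1) (hb₂ : 0 < b₂) (hb₂' : b₂ < 1) (hτ : 0 ≤ τ) (hα : 0 ≤ α) (hβ : 0 ≤ β)
    (_hγ : 0 ≤ γ) (hθ : 0 < τ + γ) :
    (a₁ * b₂ * (1 - b₁) * (1 - a₂) + a₂ * b₁ * (1 - a₁) * (1 - b₂)) * ((τ + α) * (τ + β) - τ ^ 2 / (2 * (τ + γ))) ≤
      (τ * (a₁ + a₂ - a₁ * a₂) + α * (a₁ + (1 - a₁) * a₂ * b₂ * b₁) + β * (a₂ + (1 - a₂) * a₁ * b₁ * b₂)) * (τ * (b₁ + b₂ - b₁ * b₂) + α * (b₁ + (1 - b₁) * b₂ * a₂ * a₁) + β * (b₂ + (1 - b₂) * b₁ * a₁ * a₂)) - ((τ * (a₁ * b₁ + a₂ * b₂ - a₁ * a₂ * b₁ * b₂) + α * ((a₁ * b₁ + a₂ * b₂ - a₁ * a₂ * b₁ * b₂) - a₂ * b₂ * (1 - a₁) * (1 - b₁)) + β * ((a₁ * b₁ + a₂ * b₂ - a₁ * a₂ * b₁ * b₂) - a₁ * b₁ * (1 - a₂)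 * (1 - b₂))) + (a₁ * b₂ * (1 - b₁) * (1 - a₂) + a₂ * b₁ * (1 - a₁) * (1 - b₂)) * τ) ^ 2 / (2 * ((a₁ * b₁ + a₂ * b₂ - a₁ * a₂ * b₁ * b₂) + (a₁ * b₂ * (1 - b₁) * (1 - a₂) + a₂ * b₁ * (1 - a₁) * (1 - b₂)) * (τ + γ))) := by
  have h1a : 0 < 1 - a₁ := by linarith
  have h2a : 0 < 1 - a₂ := by linarith
  have h1b : 0 < 1 - b₁ := by linarith
  have h2b : 0 < 1 - b₂ := by linarith
  have hS : 0 < (a₁ * b₁ + a₂ * b₂ - a₁ * a₂ * b₁ * b₂) := by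
    have h1 : 0 ≤ 1 - a₂ * b₂ := by nlinarith
    nlinarith [mul_pos ha₁ hb₁, mul_pos ha₂ hb₂, mul_nonneg (mul_pos ha₁ hb₁).le h1]
  have hC : 0 < (a₁ * b₂ * (1 - b₁) * (1 - a₂) + a₂ * b₁ * (1 - a₁) * (1 - b₂)) := by positivity
  -- coefficient facts (explicit polynomials), including the u ↔ v mirrored instances
  have hAB : (a₁ + a₂ - a₁ * a₂) * (b₁ + b₂ - b₁ * b₂) = (a₁ * b₁ + a₂ * b₂ - a₁ * a₂ * b₁ * b₂) + (a₁ * b₂ * (1 - b₁) * (1 - a₂) + a₂ * b₁ * (1 - a₁) * (1 - b₂)) := by ring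
  have kta0 := q_ta_nonneg ha₁.le ha₁'.le ha₂.le ha₂'.le hb₁.le hb₁'.le hb₂.le hb₂'.le
  have ktb0 := q_ta_nonneg ha₂.le ha₂'.le ha₁.le ha₁'.le hb₂.le hb₂'.le hb₁.le hb₁'.le
  have kaa := k_aa_nonneg ha₁ ha₁'.le ha₂.le ha₂'.le hb₁ hb₁'.le hb₂.le hb₂'.le
  have kbb := k_aa_nonneg ha₂ ha₂'.le ha₁.le ha₁'.le hb₂ hb₂'.le hb₁.le hb₁'.le
  have kab := GZGladkovWCert.kab_aa_nonneg ha₁.le ha₁'.le ha₂.le ha₂'.le hb₁.le hb₁'.le hb₂.le hb₂'.le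
  have kab2 := GZGladkovWCert.kab_aa_nonneg ha₂.le ha₂'.le ha₁.le ha₁'.le hb₂.le hb₂'.le hb₁.le hb₁'.le
  have eS : (a₂ * b₂ + a₁ * b₁ - a₂ * a₁ * b₂ * b₁) = (a₁ * b₁ + a₂ * b₂ - a₁ * a₂ * b₁ * b₂) := by ring
  have eC : (a₂ * b₁ * (1 - b₂) * (1 - a₁) + a₁ * b₂ * (1 - a₂) * (1 - b₁)) = (a₁ * b₂ * (1 - b₁) * (1 - a₂) + a₂ * b₁ * (1 - a₁) * (1 - b₂)) := by ring
  have eA : (a₂ + a₁ - a₂ * a₁) = (a₁ + a₂ - a₁ * a₂) := by ring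
  have eB : (b₂ + b₁ - b₂ * b₁) = (b₁ + b₂ - b₁ * b₂) := by ring
  rw [eS] at ktb0 kbb kab2
  rw [eC] at ktb0 kab2
  rw [eA, eB] at ktb0
  -- make the structured quantities opaque
  set S := (a₁ * b₁ + a₂ * b₂ - a₁ * a₂ * b₁ * b₂) with hSdef
  set C := (a₁ * b₂ * (1 - b₁) * (1 - a₂) + a₂ * b₁ * (1 - a₁) * (1 - b₂)) with hCdef
  set A := (a₁ + a₂ - a₁ * a₂) with hAdef
  set B := (b₁ + b₂ - b₁ * b₂) with hBdef
  set Ua := (a₁ + (1 - a₁) * a₂ * b₂ * b₁) with hUadef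
  set Ub := (b₁ + (1 - b₁) * b₂ * a₂ * a₁) with hUbdef
  set Va := (a₂ + (1 - a₂) * a₁ * b₁ * b₂) with hVadef
  set Vb := (b₂ + (1 - b₂) * b₁ * a₁ * a₂) with hVbdef
  set Su := (S - a₂ * b₂ * (1 - a₁) * (1 - b₁)) with hSudef
  set Sv := (S - a₁ * b₁ * (1 - a₂) * (1 - b₂)) with hSvdef
  clear_value Su Sv Ua Ub Va Vb A B C S
  clear hSudef hSvdef hUadef hUbdef hVadef hVbdef hAdef hBdef hCdef hSdef
  -- (1) two-class convexity
  have hconv := GZGladkovSP.sq_add_div_le (u₁ := τ * S + α * Su + β * Sv) (u₂ := C * τ) (v₁ := 2 * S)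
    (v₂ := 2 * (C * (τ + γ))) (by positivity) (by positivity)
  have e1 : 2 * S + 2 * (C * (τ + γ)) = 2 * (S + C * (τ + γ)) := by ring
  have e2 : (C * τ) ^ 2 / (2 * (C * (τ + γ))) = C * (τ ^ 2 / (2 * (τ + γ))) := by
    field_simp
  rw [e1, e2] at hconv
  -- (2) the quadratic form
  have hid := quad_identity S C A B Ua Ub Va Vb Su Sv τ α β
  have ktt : 0 ≤ 2 * S * (A * B - C) - S ^ 2 := by
    have e : 2 * S * (A * B - C) - S ^ 2 = S ^ 2 := by rw [hAB]; ring
    rw [e]; positivity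
  have kta : 0 ≤ 2 * S * (A * Ub + B * Ua - C - Su) := mul_nonneg (by positivity) kta0
  have ktb : 0 ≤ 2 * S * (A * Vb + B * Va - C - Sv) := by
    have := mul_nonneg (show (0:ℝ) ≤ 2 * S by positivity) ktb0; linarith
  have hquad := quad_form_nonneg_of_diag_dominance (α := α) (β := β)
    (m := (2 * S * (Ua * Vb + Va * Ub - C) - 2 * Su * Sv) + (2 * S * (Ua * Ub) - Su ^ 2) - (2 * S * (Ua * Ub) - Su ^ 2))
    kaa kbb (by linarith [kab]) (by linarith [kab2]) hα hβ
  have hQ : (τ * S + α * Su + β * Sv) ^ 2 ≤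
      2 * S * ((τ * A + α * Ua + β * Va) * (τ * B + α * Ub + β * Vb) - C * ((τ + α) * (τ + β))) := by
    linarith [hid, hquad, mul_nonneg ktt (sq_nonneg τ), mul_nonneg kta (mul_nonneg hτ hα),
      mul_nonneg ktb (mul_nonneg hτ hβ)]
  have hQ' : (τ * S + α * Su + β * Sv) ^ 2 / (2 * S) ≤
      (τ * A + α * Ua + β * Va) * (τ * B + α * Ub + β * Vb) - C * ((τ + α) * (τ + β)) := by
    rw [div_le_iff₀ (by positivity)]; linarith [hQ]
  have e3 : C * ((τ + α) * (τ + β) - τ ^ 2 / (2 * (τ + γ))) =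
      C * ((τ + α) * (τ + β)) - C * (τ ^ 2 / (2 * (τ + γ))) := by ring
  rw [e3]
  linarith [hconv, hQ']

end GZGladkovW

end Summit.CriticalPhenomena.PercolationContinuityZ3.Theorems
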